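import Summits.QuantumFields.YangMills.Theorems.InfiniteVolumePerOrderSlackCompactness
import Summits.QuantumFields.YangMills.Theorems.InfiniteVolumeTorusScheme
import HarnessLib

/-!
# Infinite volume by compactness with PER-ORDER collar constants AND UV SLACK: the torus/infinite-volume junction

Support file for `SlackWindow.SlackCalibration` (stmt-QuantumFields-23098).  Verbatim twin of the landed
`InfiniteVolumePerOrderTorusScheme` with the per-order collar currency `(Cn n/R⁴)ⁿ` replaced by route `SlackWindow`'s SLACK currency
`(Cn n/R⁴·((R·a)⁻¹)^σ)ⁿ`: the torus-side a-uniform bound (`Slack.norm_sum_weight_mul_le_slack`), its `schwartzNorm` form (order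
`(σ+10)n`, prefactor `7`), and the (A)↔(B) junction `exists_torusSides_approximating` (torus sides along which the spine's torus
plane-string distributions are asymptotic to the infinite-volume series on every `⁰𝒮ₙ`).  All deep lemmas cited BY NAME.

HONEST FRAMING: pure soft analysis ([folklore]); the ceilings are HYPOTHESES; nothing about Bałaban's RG, reflection positivity, a
mass gap or Clay; no summit is proved (rung R2a plumbing).  References: Glimm–Jaffe (1987) §6.1; Osterwalder–Schrader CMP 42 (1975) §2.
-/

set_option autoImplicit false

noncomputable section

open scoped BigOperators SchwartzMap
open MeasureTheory Filter Topology
open Literature.MathematicalPhysics.QuantumFieldTheory hiding ZdEdge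
open Literature.MathematicalPhysics.QuantumLattice
open Literature.MathematicalPhysics.AQFT
open Literature.Probability.LatticeModels (box Site)
open Summit.QuantumFields.YangMills.Cruxes.OSLegsFromFemtoAndGap.DlrCollarTransfer
  (plane torusE exists_abs_plane_le)
open Summit.QuantumFields.YangMills.Theorems.OSLegsFromFemtoAndGap
  (torusMomentStr latticeDistStr latticeDistStr_apply schwartz_exists_countable_seminorm_dense abs_torusMomentStr_plane_le
    torusE_prod_plane_eq_torusMomentStr)

open Summit.QuantumFields.YangMills.Theorems.InfiniteVolume.Slack
  (norm_sum_weight_mul_le_slack norm_tsum_weight_mul_le_slack seminorm_budget_le_schwartzNorm_slack)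

namespace Summit.QuantumFields.YangMills.Theorems.InfiniteVolume.PerOrderSlack

variable {G : Type} [Group G] [TopologicalSpace G] [IsTopologicalGroup G] [CompactSpace G]
  [MeasurableSpace G] [BorelSpace G]

/-! ## §1 The two a-uniform bounds, per-order constants -/

/-- **A-uniform bound for plane strings at shifted points, per-order constants** (verbatim the spine's
`OSLegsFromFemtoAndGap.norm_latticeSumStr_plane_le` with `C ↦ Cn n`, `K ↦ K n`). [folklore] -/
theorem norm_latticeSumStr_plane_le (r : LatticeRep G) {a : ℝ → ℝ} (Cn : ℕ → ℝ) (σ : ℕ) {β₄ ℓ₄ : ℝ}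
    (hℓ : 0 < ℓ₄) (hC : ∀ n, 0 ≤ Cn n)
    (H : ∀ β : ℝ, β₄ ≤ β →
      ∀ (L n : ℕ) (q : Fin n → Fin 4 × Fin 4) (x : Fin n → (Fin 4 → ℤ)) (R : ℕ), (∀ i, (q i).1 < (q i).2) →
        1 ≤ R → (R : ℝ) * a β ≤ ℓ₄ → 4 * R + 8 ≤ L →
        (∀ i j : Fin n, i ≠ j → ∃ k : Fin 4,
          (2 * (R : ℤ) + 4) ≤ |((((x i k - x j k : ℤ) : ZMod (2 * L + 1))).valMinAbs : ℤ)|) →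
        |torusE G r β L (fun U => ∏ i, (plane G r (q i) (x i) U - torusE G r β L (plane G r (q i) (x i))))| ≤
          (Cn n / (R : ℝ) ^ 4 * (((R : ℝ) * a β)⁻¹) ^ σ) ^ n) :
    ∃ Cp : ℝ, 0 ≤ Cp ∧ ∀ β : ℝ, β₄ ≤ β → 0 < a β → a β ≤ 1 / 24 → a β ≤ ℓ₄ →
      ∀ L : ℕ, 14 ≤ L → (a β)⁻¹ * (a β)⁻¹ ≤ L →
      ∀ n : ℕ, 2 ≤ n → ∀ q : Fin n → Fin 4 × Fin 4, (∀ i, (q i).1 < (q i).2) →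
      ∀ F : 𝓢((Fin n → (EuclideanSpace ℝ (Fin 4))), ℂ), IsOffDiagonal F →
      ∀ y : (Fin n → Site 4) → (Fin n → (EuclideanSpace ℝ (Fin 4))), (∀ x l, ‖y x l - a β • siteToE (x l)‖ ≤ 6 * a β) →
        ‖∑ x ∈ Fintype.piFinset (fun _ : Fin n => box 4 L),
            ((torusMomentStr r.ρ β L (fun i U => plaquetteObs r.ρ 0 (q i).1 (q i).2 U)
              (fun i => wilsonTorusMean r.ρ β L (fun U => plaquetteObs r.ρ 0 (q i).1 (q i).2 U)) x : ℝ) : ℂ) *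
            F (y x)‖ ≤
          (((Cp + Cp) * 4 ^ 4 * 5 ^ 6 + (Cp + Cp) * 2 ^ 6 * (10 + 2 * 6) ^ 4 + 2 ^ (σ + 11) * Cn n * (2 / ℓ₄ + 48) ^ (σ + 4)) *
              2 ^ 6 * (81 * ∑' m : ℕ, (((m : ℝ) + 1) ^ 2)⁻¹)) ^ n *
            (SchwartzMap.seminorm ℂ 0 (4 * n) F + SchwartzMap.seminorm ℂ (6 * n) (4 * n) F +
              SchwartzMap.seminorm ℂ 0 ((σ + 4) * n) F + SchwartzMap.seminorm ℂ (6 * n) ((σ + 4) * n) F +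
              SchwartzMap.seminorm ℂ 0 0 F + SchwartzMap.seminorm ℂ (6 * n) 0 F +
              SchwartzMap.seminorm ℂ (10 * n) 0 F) := by
  obtain ⟨Cp, hCp⟩ := exists_abs_plane_le (G := G) r
  have hCp0 : 0 ≤ Cp := le_trans (abs_nonneg _) (hCp (0, 1) 0 (fun _ => 1))
  refine ⟨Cp, hCp0, ?_⟩
  intro β hβ ha ha24 haℓ L hL14 hLa n hn q hq F hF y hyx
  have ha1 : a β ≤ 1 := ha24.trans (by norm_num)
  have hsa : 6 * a β ≤ 1 / 4 := by linarith
  have hM0 : 0 ≤ Cp + Cp := by positivity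
  have Hn : ∀ (x : Fin n → Site 4) (R : ℕ), 1 ≤ R → (R : ℝ) * a β ≤ ℓ₄ → 4 * R + 8 ≤ L →
      (∀ i j : Fin n, i ≠ j → ∃ k : Fin 4,
        (2 * (R : ℤ) + 4) ≤ |((((x i k - x j k : ℤ) : ZMod (2 * L + 1))).valMinAbs : ℤ)|) →
      |torusMomentStr r.ρ β L (fun i U => plaquetteObs r.ρ 0 (q i).1 (q i).2 U)
        (fun i => wilsonTorusMean r.ρ β L (fun U => plaquetteObs r.ρ 0 (q i).1 (q i).2 U)) x| ≤
        (Cn n / (R : ℝ) ^ 4 * (((R : ℝ) * a β)⁻¹) ^ σ) ^ n := fun x R hR hRa hRL hsep => by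
    rw [← torusE_prod_plane_eq_torusMomentStr]
    exact H β hβ L n q x R hq hR hRa hRL hsep
  exact norm_sum_weight_mul_le_slack hℓ (hC n) hM0 σ _ (fun x => abs_torusMomentStr_plane_le r hCp β L q x)
    Hn ha ha1 haℓ hL14 hLa hn (by norm_num) le_rfl hsa F hF y hyx

/-- **The torus a-uniform bound in `schwartzNorm` form, per-order constants** (verbatim
`InfiniteVolume.norm_latticeDistStr_le_of_momentBounds6` with `K ↦ K n`). [folklore] -/
theorem norm_latticeDistStr_le (r : LatticeRep G) {a : ℝ → ℝ} (Cn : ℕ → ℝ) (σ : ℕ) {β₄ ℓ₄ : ℝ}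
    (hℓ : 0 < ℓ₄) (hC : ∀ n, 0 ≤ Cn n)
    (H : ∀ β : ℝ, β₄ ≤ β →
      ∀ (L n : ℕ) (q : Fin n → Fin 4 × Fin 4) (x : Fin n → (Fin 4 → ℤ)) (R : ℕ), (∀ i, (q i).1 < (q i).2) →
        1 ≤ R → (R : ℝ) * a β ≤ ℓ₄ → 4 * R + 8 ≤ L →
        (∀ i j : Fin n, i ≠ j → ∃ k : Fin 4,
          (2 * (R : ℤ) + 4) ≤ |((((x i k - x j k : ℤ) : ZMod (2 * L + 1))).valMinAbs : ℤ)|) →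
        |torusE G r β L (fun U => ∏ i, (plane G r (q i) (x i) U - torusE G r β L (plane G r (q i) (x i))))| ≤
          (Cn n / (R : ℝ) ^ 4 * (((R : ℝ) * a β)⁻¹) ^ σ) ^ n) :
    ∃ Cp : ℝ, 0 ≤ Cp ∧ ∀ β : ℝ, β₄ ≤ β → 0 < a β → a β ≤ 1 / 24 → a β ≤ ℓ₄ →
      ∀ L : ℕ, 14 ≤ L → (a β)⁻¹ * (a β)⁻¹ ≤ L →
      ∀ n : ℕ, 2 ≤ n → ∀ q : Fin n → Fin 4 × Fin 4, (∀ i, (q i).1 < (q i).2) →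
      ∀ F : 𝓢((Fin n → (EuclideanSpace ℝ (Fin 4))), ℂ), IsOffDiagonal F →
        ‖latticeDistStr r.ρ β L (a β) (fun i U => plaquetteObs r.ρ 0 (q i).1 (q i).2 U)
          (fun i => wilsonTorusMean r.ρ β L (fun U => plaquetteObs r.ρ 0 (q i).1 (q i).2 U)) F‖ ≤
          7 * (((Cp + Cp) * 4 ^ 4 * 5 ^ 6 + (Cp + Cp) * 2 ^ 6 * (10 + 2 * 6) ^ 4 + 2 ^ (σ + 11) * Cn n * (2 / ℓ₄ + 48) ^ (σ + 4)) *
              2 ^ 6 * (81 * ∑' m : ℕ, (((m : ℝ) + 1) ^ 2)⁻¹)) ^ n * schwartzNorm ((σ + 10) * n) F := by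
  obtain ⟨Cp, hCp0, HT⟩ := norm_latticeSumStr_plane_le r Cn σ hℓ hC H
  refine ⟨Cp, hCp0, fun β hβ ha ha24 haℓ L hL14 hLa n hn q hq F hF => ?_⟩
  have hK0 : 0 ≤ (((Cp + Cp) * 4 ^ 4 * 5 ^ 6 + (Cp + Cp) * 2 ^ 6 * (10 + 2 * 6) ^ 4 + 2 ^ (σ + 11) * Cn n * (2 / ℓ₄ + 48) ^ (σ + 4)) *
      2 ^ 6 * (81 * ∑' m : ℕ, (((m : ℝ) + 1) ^ 2)⁻¹)) ^ n := by
    have : 0 ≤ ∑' m : ℕ, (((m : ℝ) + 1) ^ 2)⁻¹ := tsum_nonneg fun m => by positivity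
    have := hC n
    positivity
  rw [latticeDistStr_apply]
  calc _ ≤ (((Cp + Cp) * 4 ^ 4 * 5 ^ 6 + (Cp + Cp) * 2 ^ 6 * (10 + 2 * 6) ^ 4 + 2 ^ (σ + 11) * Cn n * (2 / ℓ₄ + 48) ^ (σ + 4)) *
          2 ^ 6 * (81 * ∑' m : ℕ, (((m : ℝ) + 1) ^ 2)⁻¹)) ^ n *
        (SchwartzMap.seminorm ℂ 0 (4 * n) F + SchwartzMap.seminorm ℂ (6 * n) (4 * n) F +
          SchwartzMap.seminorm ℂ 0 ((σ + 4) * n) F + SchwartzMap.seminorm ℂ (6 * n) ((σ + 4) * n) F +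
          SchwartzMap.seminorm ℂ 0 0 F + SchwartzMap.seminorm ℂ (6 * n) 0 F + SchwartzMap.seminorm ℂ (10 * n) 0 F) :=
        HT β hβ ha ha24 haℓ L hL14 hLa n hn q hq F hF (fun x l => a β • siteToE (x l)) (fun x l => by
          rw [sub_self, norm_zero]; positivity)
    _ ≤ _ * (7 * schwartzNorm ((σ + 10) * n) F) := by gcongr; exact seminorm_budget_le_schwartzNorm_slack σ n F
    _ = _ := by ring

/-! ## §2 The junction theorem, per-order constants -/

/-- **THE (A)↔(B) JUNCTION, per-order constants** (verbatim `InfiniteVolume.exists_torusSides_approximating` for a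
per-order torus collar bound: for every admissible coupling sequence, odd-torus limit states and growth demand there
are torus sides along which the spine's torus plane-string distributions are asymptotic to the infinite-volume
series, on every `⁰𝒮ₙ`). [folklore] -/
theorem exists_torusSides_approximating (r : LatticeRep G) {a : ℝ → ℝ} (Cn : ℕ → ℝ) (σ : ℕ) {β₄ ℓ₄ : ℝ}
    (hℓ : 0 < ℓ₄) (hC : ∀ n, 0 ≤ Cn n)
    (H : ∀ β : ℝ, β₄ ≤ β →
      ∀ (L n : ℕ) (q : Fin n → Fin 4 × Fin 4) (x : Fin n → (Fin 4 → ℤ)) (R : ℕ), (∀ i, (q i).1 < (q i).2) →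
        1 ≤ R → (R : ℝ) * a β ≤ ℓ₄ → 4 * R + 8 ≤ L →
        (∀ i j : Fin n, i ≠ j → ∃ k : Fin 4,
          (2 * (R : ℤ) + 4) ≤ |((((x i k - x j k : ℤ) : ZMod (2 * L + 1))).valMinAbs : ℤ)|) →
        |torusE G r β L (fun U => ∏ i, (plane G r (q i) (x i) U - torusE G r β L (plane G r (q i) (x i))))| ≤
          (Cn n / (R : ℝ) ^ 4 * (((R : ℝ) * a β)⁻¹) ^ σ) ^ n) :
    ∀ (β : ℕ → ℝ), (∀ k, β₄ ≤ β k) → (∀ k, 0 < a (β k)) → (∀ k, a (β k) ≤ 1 / 24) → (∀ k, a (β k) ≤ ℓ₄) →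
      ∀ (μ : ℕ → Measure (LGConfig 4 G)), (∀ k, μ k ∈ oddTorusLimitPoints r (β k)) →
      ∀ g : ℕ → ℕ, ∃ L : ℕ → ℕ, (∀ k, g k ≤ L k) ∧ (∀ k, 14 ≤ L k ∧ (a (β k))⁻¹ * (a (β k))⁻¹ ≤ (L k : ℝ)) ∧
        (∀ k, ∃ S : ℕ → ℕ, StrictMono S ∧ IsInfiniteVolumeLimitAlong (d := 4) r.ρ (β k) (fun j => 2 * S j) (μ k) ∧
          L k ∈ Set.range S) ∧
        ∀ n : ℕ, 2 ≤ n → ∀ q : Fin n → Fin 4 × Fin 4, (∀ i, (q i).1 < (q i).2) →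
          ∀ F : 𝓢((Fin n → (EuclideanSpace ℝ (Fin 4))), ℂ), IsOffDiagonal F →
            Tendsto (fun k => latticeDistStr r.ρ (β k) (L k) (a (β k)) (fun i U => plaquetteObs r.ρ 0 (q i).1 (q i).2 U)
                (fun i => wilsonTorusMean r.ρ (β k) (L k) (fun U => plaquetteObs r.ρ 0 (q i).1 (q i).2 U)) F -
              ∑' x : Fin n → Site 4,
                (((∫ U, ∏ i, (plane G r (q i) (x i) U - ∫ V, plane G r (q i) (x i) V ∂(μ k)) ∂(μ k) : ℝ) : ℂ)) *
                  F (fun l => a (β k) • siteToE (x l))) atTop (𝓝 0) := by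
  classical
  -- constants: torus side and infinite-volume side (both per order)
  obtain ⟨CpT, hCpT0, HT⟩ := norm_latticeDistStr_le r Cn σ hℓ hC H
  obtain ⟨Cp, hCp⟩ := exists_abs_plane_le (G := G) r
  have hCp0 : 0 ≤ Cp := le_trans (abs_nonneg _) (hCp (0, 1) 0 (fun _ => 1))
  set KT : ℕ → ℝ := fun n => ((CpT + CpT) * 4 ^ 4 * 5 ^ 6 + (CpT + CpT) * 2 ^ 6 * (10 + 2 * 6) ^ 4 +
      2 ^ (σ + 11) * Cn n * (2 / ℓ₄ + 48) ^ (σ + 4)) * 2 ^ 6 * (81 * ∑' m : ℕ, (((m : ℝ) + 1) ^ 2)⁻¹) with hKT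
  set KI : ℕ → ℝ := fun n => ((Cp + Cp) * 4 ^ 4 * 5 ^ 6 + (Cp + Cp) * 2 ^ 6 * (10 + 2 * 6) ^ 4 +
      2 ^ (σ + 11) * Cn n * (2 / ℓ₄ + 48) ^ (σ + 4)) * 2 ^ 6 * (81 * ∑' m : ℕ, (((m : ℝ) + 1) ^ 2)⁻¹) with hKI
  have hKT0 : ∀ n, 0 ≤ KT n := fun n => by
    have : 0 ≤ ∑' m : ℕ, (((m : ℝ) + 1) ^ 2)⁻¹ := tsum_nonneg fun m => by positivity
    have := hC n
    simp only [hKT]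
    positivity
  have hKI0 : ∀ n, 0 ≤ KI n := fun n => by
    have : 0 ≤ ∑' m : ℕ, (((m : ℝ) + 1) ^ 2)⁻¹ := tsum_nonneg fun m => by positivity
    have := hC n
    simp only [hKI]
    positivity
  intro β hβ ha ha24 haℓ μ hμ g
  have ha1 : ∀ k, a (β k) ≤ 1 := fun k => (ha24 k).trans (by norm_num)
  have hsa : ∀ k, (0 : ℝ) * a (β k) ≤ 1 / 4 := fun k => by simp
  haveI : ∀ k, IsProbabilityMeasure (μ k) := fun k => by
    obtain ⟨S, -, hlim⟩ := hμ k
    exact hlim.1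
  -- the defining odd-torus sequences of the states
  choose S hS hlim using hμ
  -- countable dense subsets of the `⁰𝒮ₙ`
  have hD := fun n : ℕ => schwartz_exists_countable_seminorm_dense (X := Fin n → (EuclideanSpace ℝ (Fin 4))) ((σ + 10) * n)
    {F : 𝓢((Fin n → (EuclideanSpace ℝ (Fin 4))), ℂ) | IsOffDiagonal F}
  choose D hDA hDc hDd using hD
  haveI : ∀ n, Countable (D n) := fun n => (hDc n).to_subtype
  -- the countable family of (arity, string, dense test function) and the diagonal selection
  let ι := Σ n : ℕ, (Fin n → Fin 4 × Fin 4) × (D n)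
  let u : ℕ → ι → ℕ → ℂ := fun k i m =>
    latticeDistStr r.ρ (β k) (S k m) (a (β k)) (fun l U => plaquetteObs r.ρ 0 (i.2.1 l).1 (i.2.1 l).2 U)
      (fun l => wilsonTorusMean r.ρ (β k) (S k m) (fun U => plaquetteObs r.ρ 0 (i.2.1 l).1 (i.2.1 l).2 U)) i.2.2.1
  let c : ℕ → ι → ℂ := fun k i => ∑' x : Fin i.1 → Site 4,
    (((∫ U, ∏ l, (plane G r (i.2.1 l) (x l) U - ∫ V, plane G r (i.2.1 l) (x l) V ∂(μ k)) ∂(μ k) : ℝ) : ℂ)) *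
      (i.2.2.1 : 𝓢((Fin i.1 → (EuclideanSpace ℝ (Fin 4))), ℂ)) (fun l => a (β k) • siteToE (x l))
  have hu : ∀ k i, Tendsto (fun m => u k i m) atTop (𝓝 (c k i)) := fun k i =>
    tendsto_latticeDistStr_tsum r (hS k) (hlim k) (ha k) (ha1 k) i.2.1 i.2.2.1
  -- growth demand including the thresholds of the torus bound
  obtain ⟨Ld, hLdg, hLd⟩ := exists_growth_diagonal u c hu
    (fun k => max (g k) (max 14 ⌈(a (β k))⁻¹ * (a (β k))⁻¹⌉₊))
  refine ⟨fun k => S k (Ld k), fun k => ?_, fun k => ⟨?_, ?_⟩, fun k => ⟨S k, hS k, hlim k, ⟨Ld k, rfl⟩⟩, ?_⟩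
  · exact le_trans (le_trans (le_max_left _ _) (hLdg k)) ((hS k).id_le _)
  · exact le_trans (le_trans (le_trans (le_max_left _ _) (le_max_right _ _)) (hLdg k)) ((hS k).id_le _)
  · have h1 : ((⌈(a (β k))⁻¹ * (a (β k))⁻¹⌉₊ : ℕ) : ℝ) ≤ S k (Ld k) := by
      exact_mod_cast le_trans (le_trans (le_trans (le_max_right _ _) (le_max_right _ _)) (hLdg k)) ((hS k).id_le _)
    exact (Nat.le_ceil _).trans h1
  intro n hn q hq F hF
  have hL14 : ∀ k, 14 ≤ S k (Ld k) := fun k =>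
    le_trans (le_trans (le_trans (le_max_left _ _) (le_max_right _ _)) (hLdg k)) ((hS k).id_le _)
  have hLa : ∀ k, (a (β k))⁻¹ * (a (β k))⁻¹ ≤ (S k (Ld k) : ℝ) := fun k => by
    have h1 : ((⌈(a (β k))⁻¹ * (a (β k))⁻¹⌉₊ : ℕ) : ℝ) ≤ S k (Ld k) := by
      exact_mod_cast le_trans (le_trans (le_trans (le_max_right _ _) (le_max_right _ _)) (hLdg k)) ((hS k).id_le _)
    exact (Nat.le_ceil _).trans h1
  -- shorthand for the two functionals at level `k`
  set T : ℕ → 𝓢((Fin n → (EuclideanSpace ℝ (Fin 4))), ℂ) → ℂ := fun k F' =>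
    latticeDistStr r.ρ (β k) (S k (Ld k)) (a (β k)) (fun i U => plaquetteObs r.ρ 0 (q i).1 (q i).2 U)
      (fun i => wilsonTorusMean r.ρ (β k) (S k (Ld k)) (fun U => plaquetteObs r.ρ 0 (q i).1 (q i).2 U)) F' with hTdef
  set W : ℕ → (Fin n → Site 4) → ℝ := fun k x =>
    ∫ U, ∏ i, (plane G r (q i) (x i) U - ∫ V, plane G r (q i) (x i) V ∂(μ k)) ∂(μ k) with hWdef
  set Λ : ℕ → 𝓢((Fin n → (EuclideanSpace ℝ (Fin 4))), ℂ) → ℂ := fun k F' =>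
    ∑' x : Fin n → Site 4, ((W k x : ℝ) : ℂ) * F' (fun l => a (β k) • siteToE (x l)) with hΛdef
  have hWsup : ∀ k x, |W k x| ≤ (Cp + Cp) ^ n := fun k x => abs_infVolWeight_le r hCp (μ k) q x
  have hWcol : ∀ k (x : Fin n → Site 4) (R : ℕ), 1 ≤ R → (R : ℝ) * a (β k) ≤ ℓ₄ →
      (∀ i j : Fin n, i ≠ j → ∃ m : Fin 4, (2 * (R : ℤ) + 4) ≤ |x i m - x j m|) →
      |W k x| ≤ (Cn n / (R : ℝ) ^ 4 * (((R : ℝ) * a (β k))⁻¹) ^ σ) ^ n := fun k x R hR hRa hsep =>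
    momentBound_oddTorusLimitPoints r Cn σ H (hβ k) ⟨S k, hS k, hlim k⟩ q x R hq hR hRa hsep
  have hy0 : ∀ k (x : Fin n → Site 4) l, ‖(fun l => a (β k) • siteToE (x l)) l - a (β k) • siteToE (x l)‖ ≤
      0 * a (β k) := fun k x l => by simp
  have hy6 : ∀ k (x : Fin n → Site 4) l, ‖(fun l => a (β k) • siteToE (x l)) l - a (β k) • siteToE (x l)‖ ≤
      6 * a (β k) := fun k x l => by rw [sub_self, norm_zero]; exact mul_nonneg (by norm_num) (ha k).le
  -- the two a-uniform bounds on `⁰𝒮ₙ`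
  have hTb : ∀ k (F' : 𝓢((Fin n → (EuclideanSpace ℝ (Fin 4))), ℂ)), IsOffDiagonal F' →
      ‖T k F'‖ ≤ 7 * KT n ^ n * schwartzNorm ((σ + 10) * n) F' := fun k F' hF' =>
    HT (β k) (hβ k) (ha k) (ha24 k) (haℓ k) (S k (Ld k)) (hL14 k) (hLa k) n hn q hq F' hF'
  have hΛb : ∀ k (F' : 𝓢((Fin n → (EuclideanSpace ℝ (Fin 4))), ℂ)), IsOffDiagonal F' →
      ‖Λ k F'‖ ≤ 7 * KI n ^ n * schwartzNorm ((σ + 10) * n) F' := fun k F' hF' =>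
    norm_tsum_weight_mul_le_slack hℓ (hC n) (by positivity : 0 ≤ Cp + Cp) σ (W k) (hWsup k) (hWcol k) (ha k) (ha1 k)
      (haℓ k) hn (by norm_num) le_rfl (by linarith [ha24 k]) F' hF' _ (hy6 k)
  -- linearity
  have hTsub : ∀ k (F' F'' : 𝓢((Fin n → (EuclideanSpace ℝ (Fin 4))), ℂ)), T k (F' - F'') = T k F' - T k F'' :=
    fun k F' F'' => by simp only [hTdef, map_sub]
  have hΛsub : ∀ k (F' F'' : 𝓢((Fin n → (EuclideanSpace ℝ (Fin 4))), ℂ)), Λ k (F' - F'') = Λ k F' - Λ k F'' :=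
    fun k F' F'' => tsum_weight_mul_sub (ha k) (ha1 k) (hsa k) (pow_nonneg (by positivity) n) (W k) (hWsup k) _
      (hy0 k) F' F''
  -- convergence on the dense set, then everywhere on `⁰𝒮ₙ` by `ε/3`
  have hdense : ∀ d ∈ D n, Tendsto (fun k => T k d - Λ k d) atTop (𝓝 0) := fun d hd =>
    tendsto_sub_diagonal hLd ⟨n, q, ⟨d, hd⟩⟩
  rw [NormedAddGroup.tendsto_nhds_zero]
  intro ε hε
  have hden : 0 < 7 * KT n ^ n + 7 * KI n ^ n + 1 := by
    have := pow_nonneg (hKT0 n) n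
    have := pow_nonneg (hKI0 n) n
    positivity
  obtain ⟨d, hd, hdε⟩ := hDd n F hF (ε / (2 * (7 * KT n ^ n + 7 * KI n ^ n + 1))) (by positivity)
  have hdD : IsOffDiagonal d := hDA n hd
  have hsmall := (NormedAddGroup.tendsto_nhds_zero.1 (hdense d hd)) (ε / 2) (by positivity)
  filter_upwards [hsmall] with k hk
  have h1 : T k F - Λ k F = (T k (F - d) - Λ k (F - d)) + (T k d - Λ k d) := by
    rw [hTsub, hΛsub]; ring
  rw [h1]
  have h2 : ‖T k (F - d) - Λ k (F - d)‖ ≤ (7 * KT n ^ n + 7 * KI n ^ n) * schwartzNorm ((σ + 10) * n) (F - d) := by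
    calc _ ≤ ‖T k (F - d)‖ + ‖Λ k (F - d)‖ := norm_sub_le _ _
      _ ≤ 7 * KT n ^ n * schwartzNorm ((σ + 10) * n) (F - d) + 7 * KI n ^ n * schwartzNorm ((σ + 10) * n) (F - d) :=
          add_le_add (hTb k _ (hF.sub hdD)) (hΛb k _ (hF.sub hdD))
      _ = _ := by ring
  have h3 : (7 * KT n ^ n + 7 * KI n ^ n) * schwartzNorm ((σ + 10) * n) (F - d) < ε / 2 := by
    have hq' : (7 * KT n ^ n + 7 * KI n ^ n) * schwartzNorm ((σ + 10) * n) (F - d) ≤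
        (7 * KT n ^ n + 7 * KI n ^ n + 1) * schwartzNorm ((σ + 10) * n) (F - d) :=
      mul_le_mul_of_nonneg_right (by linarith) (schwartzNorm_nonneg _ _)
    have hq'' : (7 * KT n ^ n + 7 * KI n ^ n + 1) * schwartzNorm ((σ + 10) * n) (F - d) <
        (7 * KT n ^ n + 7 * KI n ^ n + 1) * (ε / (2 * (7 * KT n ^ n + 7 * KI n ^ n + 1))) :=
      mul_lt_mul_of_pos_left hdε hden
    have hq''' : (7 * KT n ^ n + 7 * KI n ^ n + 1) * (ε / (2 * (7 * KT n ^ n + 7 * KI n ^ n + 1))) = ε / 2 := by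
      rw [mul_div_assoc', div_eq_iff (mul_pos two_pos hden).ne']
      ring
    linarith
  calc ‖T k (F - d) - Λ k (F - d) + (T k d - Λ k d)‖
      ≤ ‖T k (F - d) - Λ k (F - d)‖ + ‖T k d - Λ k d‖ := norm_add_le _ _
    _ < ε / 2 + ε / 2 := add_lt_add (lt_of_le_of_lt h2 h3) hk
    _ = ε := by ring

end Summit.QuantumFields.YangMills.Theorems.InfiniteVolume.PerOrderSlack

end
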